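import Summits.RiemannHypothesis.RiemannHypothesis.Theorems.JensenPolynomialsSkeletonRatios

/-!
# Route `JensenPolynomials` — rung J-P (P1⁺): the MARGIN inequality `|P(e)/P⁰(e) − 1| ≤ F(d,n)` as a kernel schema

**RH-FREE, ξ-free.** The DATA half of rung J-D (b) measured the margin `μ(d,n) = min_i P(e_i)/P⁰(e_i)` of the skeleton sign test
(eng-3 g2, ET7; `1 − μ(d,10⁴) = 0.00145 (d = 3) … 0.0705 (d = 20)`) and checked it against the CAL majorant `F(d,n) = Σ_{m=3}^{d} E_m K_m`
(`1 − μ ≤ F`, slack `σ = F/(1−μ) ≥ 2.16`). This file is the kernel form of that comparison, for an ARBITRARY real sequence `γ`: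
under the hypotheses of the blueprint `skeletonSignTest_of_tables` (tables `E_m ≥ |C(d,m) f_m|`, `|A^{d−m}_{s_n}(e)| ≤ K_m |A^d_{s_n}(e)|`
at the critical points, `r_n = f ⋆ s_n` up to `d`), at every critical point `e` of the skeleton

  `|P(e)/P⁰(e) − 1| ≤ Σ_{m=3}^{d} E_m K_m`   (`abs_ratio_sub_one_le_of_tables`),

hence `P(e)/P⁰(e) ≥ 1 − F` (`one_sub_le_ratio_of_tables`): the certified margin of any cell is at least `1 − F(d,n)`. No `Σ E K < 1`
hypothesis is needed for the inequality itself. WHAT THIS IS NOT: no table is supplied and no cell is evaluated here; the numbers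
quoted above are the DATA engine's certified numerics, not kernel facts; nothing here bears on the truth of RH.
-/

noncomputable section
-- D-0017: `Summit.RiemannHypothesis.RiemannHypothesis.…` duplicates the namespace BY DESIGN (single-problem summit).
set_option linter.dupNamespace false

namespace Summit.RiemannHypothesis.RiemannHypothesis.Theorems.JensenPolynomials

open Literature.NumberTheory.LFunctions Polynomial Finset
open scoped BigOperators Nat

/-- **Margin schema (RH-FREE, ξ-free).** With `γ(n), γ(n+1) ≠ 0`, `κ_n > 0`, `d ≥ 2`, `r_n = f ⋆ s_n` up to index `d`, and tables
`E_m ≥ |C(d,m) f_m|`, `|A^{d−m}_{s_n}(e)| ≤ K_m·|A^d_{s_n}(e)|` at every critical point `e` of the skeleton `P⁰ = A^d_{s_n}`: at every such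
`e`, `P⁰(e) ≠ 0` and `|P(e)/P⁰(e) − 1| ≤ Σ_{m=3}^{d} E_m K_m` (`P = A^d_{r_n}`). -/
theorem abs_ratio_sub_one_le_of_tables (γ : ℕ → ℝ) (d n : ℕ) (hd : 2 ≤ d) (hn : γ n ≠ 0) (hn1 : γ (n + 1) ≠ 0)
    (hκ : 0 < skelKappa γ n) (f : ℕ → ℝ)
    (hf : ∀ j ≤ d, windowSeq γ n j = ∑ i ∈ range (j + 1), (j.choose i : ℝ) * f (j - i) * skeletonSeq γ n i)
    (E K : ℕ → ℝ) (hE : ∀ m ∈ Ico 3 (d + 1), |(d.choose m : ℝ) * f m| ≤ E m)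
    (hK : ∀ m ∈ Ico 3 (d + 1), ∀ e : ℝ, (derivative (appellPoly (skeletonSeq γ n) d)).eval e = 0 →
      |(appellPoly (skeletonSeq γ n) (d - m)).eval e| ≤ K m * |(appellPoly (skeletonSeq γ n) d).eval e|)
    {e : ℝ} (he : (derivative (appellPoly (skeletonSeq γ n) d)).eval e = 0) :
    (appellPoly (skeletonSeq γ n) d).eval e ≠ 0 ∧
      |(appellPoly (windowSeq γ n) d).eval e / (appellPoly (skeletonSeq γ n) d).eval e - 1| ≤
        ∑ m ∈ Ico 3 (d + 1), E m * K m := by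
  have hκsq : 0 ≤ skelKappaSq γ n := by
    by_contra hneg
    rw [skelKappa, Real.sqrt_eq_zero'.mpr (not_le.mp hneg).le] at hκ
    exact lt_irrefl _ hκ
  have hr0 : windowSeq γ n 0 = 1 := windowSeq_zero γ n hn
  have hs0 : skeletonSeq γ n 0 = 1 := skeletonSeq_zero γ n
  have hrs1 : windowSeq γ n 1 = skeletonSeq γ n 1 := by rw [windowSeq_one γ n hn hn1, skeletonSeq_one]
  have hrs2 : windowSeq γ n 2 = skeletonSeq γ n 2 := (skeletonSeq_two γ n hκsq).symm
  obtain ⟨-, hQnd, -⟩ := splits_nodup_appellPoly_skeletonSeq γ n d hκ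
  have hQne : appellPoly (skeletonSeq γ n) d ≠ 0 := appellPoly_ne_zero _ d (by rw [hs0]; exact one_ne_zero)
  set q := (appellPoly (skeletonSeq γ n) d).eval e with hq
  have hq0 : q ≠ 0 := eval_ne_zero_of_derivative_eval_eq_zero hQne hQnd he
  refine ⟨hq0, ?_⟩
  have hexp := eval_appellPoly_binomConv_eq hd hf hr0 hs0 hrs1 hrs2 e
  set T := ∑ m ∈ Ico 3 (d + 1), (d.choose m : ℝ) * f m * (appellPoly (skeletonSeq γ n) (d - m)).eval e with hT
  have hTle : |T| ≤ (∑ m ∈ Ico 3 (d + 1), E m * K m) * |q| := by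
    calc |T| ≤ ∑ m ∈ Ico 3 (d + 1), |(d.choose m : ℝ) * f m * (appellPoly (skeletonSeq γ n) (d - m)).eval e| :=
          Finset.abs_sum_le_sum_abs _ _
      _ ≤ ∑ m ∈ Ico 3 (d + 1), E m * K m * |q| := by
          refine Finset.sum_le_sum fun m hm => ?_
          rw [abs_mul, mul_assoc]
          exact mul_le_mul (hE m hm) (hK m hm e he) (abs_nonneg _) ((abs_nonneg _).trans (hE m hm))
      _ = (∑ m ∈ Ico 3 (d + 1), E m * K m) * |q| := by rw [Finset.sum_mul]
  rw [hexp, ← hq, show (q + T) / q - 1 = T / q by field_simp; ring, abs_div]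
  rwa [div_le_iff₀ (abs_pos.mpr hq0)]

/-- **The margin is at least `1 − F`**: under the same tables, at every critical point `e` of the skeleton,
`1 − Σ_{m=3}^{d} E_m K_m ≤ P(e)/P⁰(e)` (and `P(e)/P⁰(e) ≤ 1 + Σ E_m K_m`). For `Σ E_m K_m < 1` this is the quantitative form of the
blueprint `skeletonSignTest_of_tables`; it is the kernel shape of the DATA check `1 − μ(d,n) ≤ F(d,n)` (ET7 §5). RH-FREE, ξ-free. -/
theorem one_sub_le_ratio_of_tables (γ : ℕ → ℝ) (d n : ℕ) (hd : 2 ≤ d) (hn : γ n ≠ 0) (hn1 : γ (n + 1) ≠ 0)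
    (hκ : 0 < skelKappa γ n) (f : ℕ → ℝ)
    (hf : ∀ j ≤ d, windowSeq γ n j = ∑ i ∈ range (j + 1), (j.choose i : ℝ) * f (j - i) * skeletonSeq γ n i)
    (E K : ℕ → ℝ) (hE : ∀ m ∈ Ico 3 (d + 1), |(d.choose m : ℝ) * f m| ≤ E m)
    (hK : ∀ m ∈ Ico 3 (d + 1), ∀ e : ℝ, (derivative (appellPoly (skeletonSeq γ n) d)).eval e = 0 →
      |(appellPoly (skeletonSeq γ n) (d - m)).eval e| ≤ K m * |(appellPoly (skeletonSeq γ n) d).eval e|)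
    {e : ℝ} (he : (derivative (appellPoly (skeletonSeq γ n) d)).eval e = 0) :
    1 - ∑ m ∈ Ico 3 (d + 1), E m * K m ≤
        (appellPoly (windowSeq γ n) d).eval e / (appellPoly (skeletonSeq γ n) d).eval e ∧
      (appellPoly (windowSeq γ n) d).eval e / (appellPoly (skeletonSeq γ n) d).eval e ≤
        1 + ∑ m ∈ Ico 3 (d + 1), E m * K m := by
  obtain ⟨-, h⟩ := abs_ratio_sub_one_le_of_tables γ d n hd hn hn1 hκ f hf E K hE hK he
  constructor
  · linarith [neg_abs_le ((appellPoly (windowSeq γ n) d).eval e / (appellPoly (skeletonSeq γ n) d).eval e - 1)]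
  · linarith [le_abs_self ((appellPoly (windowSeq γ n) d).eval e / (appellPoly (skeletonSeq γ n) d).eval e - 1)]

/-- **Margin schema for `ξ`** (the non-degeneracy inputs `γ > 0`, `κ_n > 0` are tree theorems): tables at a cell `(d, n)`, `d ≥ 2`,
bound the ET7 margin ratio from both sides, `|P(e)/P⁰(e) − 1| ≤ Σ_{m=3}^{d} E_m K_m` at every critical point. RH-FREE. -/
theorem abs_ratio_sub_one_le_of_tables_xi (d n : ℕ) (hd : 2 ≤ d) (f : ℕ → ℝ)
    (hf : ∀ j ≤ d, windowSeq xiTaylorCoeff n j =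
      ∑ i ∈ range (j + 1), (j.choose i : ℝ) * f (j - i) * skeletonSeq xiTaylorCoeff n i)
    (E K : ℕ → ℝ) (hE : ∀ m ∈ Ico 3 (d + 1), |(d.choose m : ℝ) * f m| ≤ E m)
    (hK : ∀ m ∈ Ico 3 (d + 1), ∀ e : ℝ, (derivative (appellPoly (skeletonSeq xiTaylorCoeff n) d)).eval e = 0 →
      |(appellPoly (skeletonSeq xiTaylorCoeff n) (d - m)).eval e| ≤
        K m * |(appellPoly (skeletonSeq xiTaylorCoeff n) d).eval e|)
    {e : ℝ} (he : (derivative (appellPoly (skeletonSeq xiTaylorCoeff n) d)).eval e = 0) :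
    |(appellPoly (windowSeq xiTaylorCoeff n) d).eval e / (appellPoly (skeletonSeq xiTaylorCoeff n) d).eval e - 1| ≤
      ∑ m ∈ Ico 3 (d + 1), E m * K m :=
  (abs_ratio_sub_one_le_of_tables xiTaylorCoeff d n hd (xiTaylorCoeff_pos_holds n).ne'
    (xiTaylorCoeff_pos_holds (n + 1)).ne' (skelKappa_xi_pos n) f hf E K hE hK he).2

end Summit.RiemannHypothesis.RiemannHypothesis.Theorems.JensenPolynomials

end
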